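import Literature.Computability.Complexity.BranchingProgramEntropy
import HarnessLib

/-!
# Route SzkEntropy, crux `PeaThreeNotInP` (stmt-PneNP-10776), line `SketchIdeator3`, socket rider:
# the output bits of a signed affine form are computed by branching programs (the carry automaton)

Socket CLIENTS of `PEDBP` / `PEABP` (`BranchingProgramEntropy.lean`: samplers whose output bits
are deterministic branching programs in the raw format `RawBP`, nodes `(tag, x, lo, hi)`, root the
LAST node, compiled by `RawBP.compile`) present INTEGER AFFINE FORMS of the input bits, written in
binary (lattice samplers `(b, z, e) ↦ B z + e + b t`, number-theoretic samplers).  This file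
certifies that each output bit of such a form is computed by a polynomial-size program:

* `affineVal cs u` — the value `Σ_k c_k u_k + Σ_{c_k < 0} |c_k|` (a nonnegative translate of the
  signed form; translation does not change the output entropy): the sum of the ACTIVE WEIGHTS
  `a_k = |c_k|` if the literal of `k` (`u_k` if `c_k ≥ 0`, `¬ u_k` if `c_k < 0`) is true, else `0`.
* `affineBitRaw cs j` — **the carry automaton** of bit `j` (schoolbook addition of the `N = |cs|`
  numerals `a_k` column by column, keeping only the column count): flow states `(i, k, s)` = "bit
  position `i ≤ j`, about to read summand `k < N`, count `s < S = 2N + 3`", laid out in CLOSED FORM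
  — state `(i, k, s)` has flow number `φ = (i N + k) S + s < L = (j + 1) N S` and is node
  `L + 1 - φ` of `[1-sink, 0-sink] ++ (states by decreasing φ)`; successors have larger `φ`, the
  root (last node) is the start state `(0, 0, 0)`.  State `(i, k, s)` tests `u_k`, the successor
  of the true literal has count `s + bit_i |c_k|`, the other count `s`; after the last summand of
  column `i < j` the automaton moves to `(i + 1, 0, s / 2)` (the carry), after the last summand of
  column `j` to the sink labelled `s % 2`.  Size `L + 2 = O(j N²)`.
* `stub_affineBitRaw_fn` — the program is VALID and COMPUTES bit `j` of `affineVal cs u`.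

Proof (the schoolbook invariant): with `carry_i = (Σ_k a_k mod 2^i) / 2^i ≤ N` and
`col_i = Σ_k bit_i a_k`: `carry_0 = 0`, `carry_{i+1} = (carry_i + col_i) / 2`,
`bit_i (Σ_k a_k) = (carry_i + col_i) mod 2`; the state `(i, k, carry_i + Σ_{k'<k} bit_i a_{k'})`
computes bit `j` of the sum, by induction on `(j - i, N - k)` reading the raw entries.
[I. Wegener, *Branching programs and binary decision diagrams*, SIAM 2000, §1.1 (programs for
addition and counting); folklore]
-/

namespace Summit.PneNP.PneNP.Cruxes.PeaThreeNotInP.SocketBP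

set_option linter.dupNamespace false -- `Summit.PneNP.PneNP.…`: summit = sub-problem name (D-0017)

open Literature.Computability.Complexity Finset

/-! ### The affine form and its carry automaton -/

/-- **Value of the signed affine form**: nonnegative coefficients weigh the literal `u_k`,
negative ones the literal `¬ u_k` — `Σ_k c_k u_k + Σ_{c_k < 0} |c_k|`, a NONNEGATIVE translate of
the integer form `Σ_k c_k u_k`. [folklore] -/
def affineVal (cs : List ℤ) (u : Fin cs.length → Bool) : ℕ :=
  ∑ k : Fin cs.length, (if 0 ≤ cs[k] then (if u k then (cs[k]).natAbs else 0) else (if u k then 0 else (cs[k]).natAbs))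

/-- The count range `S = 2N + 3` of the carry automaton of `N = |cs|` summands. [folklore] -/
def affineS (cs : List ℤ) : ℕ := 2 * cs.length + 3

/-- The number `L = (j + 1) · N · S` of flow states `(i, k, s)` of the automaton of bit `j`.
[folklore] -/
def affineL (cs : List ℤ) (j : ℕ) : ℕ := (j + 1) * cs.length * affineS cs

/-- The node index `L + 1 - φ` of the flow state with flow number `φ = q S + s` (`q = i N + k` its
row, `s` its count); nodes `0`, `1` are the sinks, larger flow numbers are earlier nodes.
[folklore] -/
def affineIdx (cs : List ℤ) (j q s : ℕ) : ℕ := affineL cs j + 1 - (q * affineS cs + s)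

/-- The node index of the successor of flow state `(i, k, ·)` when the count after reading
summand `k` is `s`: the next summand `(i, k + 1, s)`; after the last summand, the next column's
first summand `(i + 1, 0, s / 2)` (the carry) if `i < j`, the sink labelled `s % 2` (node
`(s + 1) % 2`) if `i = j`. [folklore] -/
def affineSucc (cs : List ℤ) (j i k s : ℕ) : ℕ :=
  if k + 1 < cs.length then affineIdx cs j (i * cs.length + k + 1) s
  else if i < j then affineIdx cs j ((i + 1) * cs.length) (s / 2)
  else (s + 1) % 2

/-- The raw node of flow state `(i, k, s)`: test `u_k`; the successor of the TRUE LITERAL (`hi` if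
`c_k ≥ 0`, `lo` if `c_k < 0`) adds bit `i` of `|c_k|` to the count, the other one adds `0`.
[folklore] -/
def affineNode (cs : List ℤ) (j i k s : ℕ) : RawBPNode :=
  (2, k, affineSucc cs j i k (s + if 0 ≤ cs.getD k 0 then 0 else (cs.getD k 0).natAbs / 2 ^ i % 2),
    affineSucc cs j i k (s + if 0 ≤ cs.getD k 0 then (cs.getD k 0).natAbs / 2 ^ i % 2 else 0))

/-- **The carry automaton of bit `j` of the affine form `cs`**, a raw branching program over the
`N = |cs|` input bits: the `1`-sink, the `0`-sink, then the `L` flow states by decreasing flow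
number (node `m + 2` is the state with `φ = L - 1 - m`: `i = φ / S / N`, `k = φ / S % N`,
`s = φ % S`); the root (last node) is the start state `(0, 0, 0)` — for `N = 0` the `0`-sink.
[Wegener 2000, §1.1; folklore] -/
def affineBitRaw (cs : List ℤ) (j : ℕ) : RawBP :=
  [(1, 0, 0, 0), (0, 0, 0, 0)] ++
    (List.range (affineL cs j)).reverse.map fun φ =>
      affineNode cs j (φ / affineS cs / cs.length) (φ / affineS cs % cs.length) (φ % affineS cs)

namespace SocketAffineBit

/-! ### Node-level unfolding of `RawBP.toBDD` -/

/-- A raw sink (tag `< 2`) evaluates to its label `[tag = 1]`. [folklore] -/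
theorem eval_sink {n : ℕ} {B : RawBP} (h : RawBP.Valid n B) (z : Fin n → Bool) {i : ℕ}
    (hi : i < B.length) {t x lo hi' : ℕ} (he : B[i] = (t, x, lo, hi')) (ht : t < 2) :
    (RawBP.toBDD n B h).eval z ⟨i, hi⟩ = decide (t = 1) := by
  apply BDD.eval_of_leaf
  show RawBP.nodeOf n B h ⟨i, hi⟩ = _
  have he' : B[(⟨i, hi⟩ : Fin B.length)] = (t, x, lo, hi') := he
  unfold RawBP.nodeOf
  split
  · rename_i h2; rw [he'] at h2; exact absurd h2 (by change ¬ 2 ≤ t; omega)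
  · rw [he']

/-- A raw decision node (tag `≥ 2`) follows the tested variable. [folklore] -/
theorem eval_branch {n : ℕ} {B : RawBP} (h : RawBP.Valid n B) (z : Fin n → Bool) {i : ℕ}
    (hi : i < B.length) {t x lo hi' : ℕ} (he : B[i] = (t, x, lo, hi')) (ht : 2 ≤ t) (hx : x < n)
    (hlo : lo < B.length) (hhi : hi' < B.length) :
    (RawBP.toBDD n B h).eval z ⟨i, hi⟩ =
      if z ⟨x, hx⟩ then (RawBP.toBDD n B h).eval z ⟨hi', hhi⟩
      else (RawBP.toBDD n B h).eval z ⟨lo, hlo⟩ := by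
  apply BDD.eval_of_branch
  show RawBP.nodeOf n B h ⟨i, hi⟩ = _
  have he' : B[(⟨i, hi⟩ : Fin B.length)] = (t, x, lo, hi') := he
  unfold RawBP.nodeOf
  split
  · congr 1 <;> apply Fin.ext <;> simp [he']
  · rename_i h2; rw [he'] at h2; exact absurd ht h2

/-! ### Schoolbook addition: carries and column sums -/

/-- The carry INTO column `i` of the addition of the numerals `a_k`. [folklore] -/
def carry {N : ℕ} (a : Fin N → ℕ) (i : ℕ) : ℕ := (∑ k, a k % 2 ^ i) / 2 ^ i

/-- The partial column sum: the bits `i` of the first `k` numerals. [folklore] -/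
def pcol {N : ℕ} (a : Fin N → ℕ) (i k : ℕ) : ℕ :=
  ∑ k' ∈ range k, if h : k' < N then a ⟨k', h⟩ / 2 ^ i % 2 else 0

/-- No carry into column `0`. [folklore] -/
theorem carry_zero {N : ℕ} (a : Fin N → ℕ) : carry a 0 = 0 := by
  simp [carry, Nat.mod_one]

/-- The empty partial column sum. [folklore] -/
theorem pcol_zero {N : ℕ} (a : Fin N → ℕ) (i : ℕ) : pcol a i 0 = 0 := by
  simp [pcol]

/-- One more numeral in the column. [folklore] -/
theorem pcol_succ {N : ℕ} (a : Fin N → ℕ) (i : ℕ) {k : ℕ} (hk : k < N) :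
    pcol a i (k + 1) = pcol a i k + a ⟨k, hk⟩ / 2 ^ i % 2 := by
  simp [pcol, Finset.sum_range_succ, hk]

/-- The full column sum. [folklore] -/
theorem pcol_full {N : ℕ} (a : Fin N → ℕ) (i : ℕ) : pcol a i N = ∑ k, a k / 2 ^ i % 2 := by
  unfold pcol
  rw [← Fin.sum_univ_eq_sum_range]
  exact Finset.sum_congr rfl fun k _ => by simp

/-- A partial column sum of `k` bits is at most `k`. [folklore] -/
theorem pcol_le {N : ℕ} (a : Fin N → ℕ) (i k : ℕ) : pcol a i k ≤ k := by
  unfold pcol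
  calc (∑ k' ∈ range k, if h : k' < N then a ⟨k', h⟩ / 2 ^ i % 2 else 0)
      ≤ ∑ _k' ∈ range k, 1 := Finset.sum_le_sum fun k' _ => by split <;> omega
    _ = k := by simp

/-- The carry of `N` numerals is at most `N`. [folklore] -/
theorem carry_le {N : ℕ} (a : Fin N → ℕ) (i : ℕ) : carry a i ≤ N := by
  unfold carry
  apply Nat.div_le_of_le_mul
  calc ∑ k, a k % 2 ^ i ≤ ∑ _k : Fin N, 2 ^ i :=
        Finset.sum_le_sum fun k _ => (Nat.mod_lt _ (Nat.two_pow_pos i)).le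
    _ = 2 ^ i * N := by simp [mul_comm]

/-- **The carry recursion** `carry_{i+1} = (carry_i + col_i) / 2`. [folklore] -/
theorem carry_succ {N : ℕ} (a : Fin N → ℕ) (i : ℕ) :
    carry a (i + 1) = (carry a i + pcol a i N) / 2 := by
  unfold carry
  have hs : ∑ k, a k % 2 ^ (i + 1) = (∑ k, a k % 2 ^ i) + 2 ^ i * ∑ k, a k / 2 ^ i % 2 := by
    rw [Finset.mul_sum, ← Finset.sum_add_distrib]
    exact Finset.sum_congr rfl fun k _ => Nat.mod_pow_succ
  rw [pcol_full, hs, Nat.pow_succ, ← Nat.div_div_eq_div_mul,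
    Nat.add_mul_div_left _ _ (Nat.two_pow_pos i)]

/-- **The output bit** `bit_i (Σ_k a_k) = (carry_i + col_i) mod 2`. [folklore] -/
theorem testBit_sum {N : ℕ} (a : Fin N → ℕ) (i : ℕ) :
    (∑ k, a k).testBit i = decide ((carry a i + pcol a i N) % 2 = 1) := by
  have hV : ∑ k, a k = 2 ^ i * (∑ k, a k / 2 ^ i) + ∑ k, a k % 2 ^ i := by
    rw [Finset.mul_sum, ← Finset.sum_add_distrib]
    exact Finset.sum_congr rfl fun k _ => (Nat.div_add_mod (a k) (2 ^ i)).symm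
  have hm := Finset.sum_nat_mod (Finset.univ : Finset (Fin N)) 2 (fun k => a k / 2 ^ i)
  rw [Nat.testBit_eq_decide_div_mod_eq, pcol_full, carry, hV, Nat.mul_add_div (Nat.two_pow_pos i)]
  congr 2
  omega

/-- The active weight of summand `k`: `|c_k|` if its literal is true, `0` otherwise (the summand
of `affineVal`). [folklore] -/
def wt (cs : List ℤ) (u : Fin cs.length → Bool) (k : Fin cs.length) : ℕ :=
  if 0 ≤ cs[k] then (if u k then (cs[k]).natAbs else 0) else (if u k then 0 else (cs[k]).natAbs)

/-! ### Structure of the program -/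

/-- The program has `L + 2` nodes. [folklore] -/
theorem length_affineBitRaw (cs : List ℤ) (j : ℕ) :
    (affineBitRaw cs j).length = affineL cs j + 2 := by
  simp only [affineBitRaw, List.length_append, List.length_cons, List.length_nil, List.length_map,
    List.length_reverse, List.length_range]
  omega

/-- Nodes `0` and `1` are the `1`-sink and the `0`-sink. [folklore] -/
theorem getElem_sink (cs : List ℤ) (j : ℕ) {b : ℕ} (hb : b < 2) (h : b < (affineBitRaw cs j).length) :
    (affineBitRaw cs j)[b] = (1 - b, 0, 0, 0) := by
  interval_cases b <;> simp [affineBitRaw]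

/-- Node `m + 2` is the flow state with flow number `φ = L - 1 - m`. [folklore] -/
theorem getElem_node (cs : List ℤ) (j m : ℕ) (h : m + 2 < (affineBitRaw cs j).length) :
    (affineBitRaw cs j)[m + 2] =
      affineNode cs j ((affineL cs j - 1 - m) / affineS cs / cs.length)
        ((affineL cs j - 1 - m) / affineS cs % cs.length) ((affineL cs j - 1 - m) % affineS cs) := by
  simp [affineBitRaw, List.getElem_reverse]

/-- Decoding a flow number: `φ = (φ / S / N · N + φ / S % N) S + φ % S`. [folklore] -/
theorem decode_eq (φ N S : ℕ) : (φ / S / N * N + φ / S % N) * S + φ % S = φ := by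
  rw [Nat.mul_comm (φ / S / N) N, Nat.div_add_mod (φ / S) N, Nat.mul_comm, Nat.div_add_mod φ S]

/-- Decoding the flow number `φ = (i N + k) S + s` of a state gives back `(i, k, s)`. [folklore] -/
theorem decode_state {N S i k s : ℕ} (hk : k < N) (hs : s < S) :
    ((i * N + k) * S + s) / S / N = i ∧ ((i * N + k) * S + s) / S % N = k ∧
      ((i * N + k) * S + s) % S = s := by
  have e1 : ((i * N + k) * S + s) / S = i * N + k := by
    rw [Nat.add_comm, Nat.add_mul_div_right _ _ (by omega), Nat.div_eq_of_lt hs, Nat.zero_add]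
  refine ⟨?_, ?_, ?_⟩
  · rw [e1, Nat.add_comm, Nat.add_mul_div_right _ _ (by omega), Nat.div_eq_of_lt hk, Nat.zero_add]
  · rw [e1, Nat.add_comm, Nat.add_mul_mod_self_right, Nat.mod_eq_of_lt hk]
  · rw [Nat.add_comm, Nat.add_mul_mod_self_right, Nat.mod_eq_of_lt hs]

/-- Flow numbers of states are `< L`. [folklore] -/
theorem phi_lt {cs : List ℤ} {j i k s : ℕ} (hi : i ≤ j) (hk : k < cs.length) (hs : s < affineS cs) :
    (i * cs.length + k) * affineS cs + s < affineL cs j := by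
  have h1 : i * cs.length + k + 1 ≤ (j + 1) * cs.length := by
    have := Nat.mul_le_mul_right cs.length hi
    rw [Nat.add_one_mul]; omega
  calc (i * cs.length + k) * affineS cs + s
      < (i * cs.length + k) * affineS cs + affineS cs := by omega
    _ = (i * cs.length + k + 1) * affineS cs := by rw [Nat.add_one_mul]
    _ ≤ (j + 1) * cs.length * affineS cs := Nat.mul_le_mul_right _ h1

/-- **The raw entry of a flow state** `(i, k, s)` is its node `affineNode cs j i k s`. [folklore] -/
theorem getElem_state {cs : List ℤ} {j i k s : ℕ} (hi : i ≤ j) (hk : k < cs.length)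
    (hs : s < affineS cs) (r : ℕ) (hr : r = affineIdx cs j (i * cs.length + k) s)
    (h : r < (affineBitRaw cs j).length) : (affineBitRaw cs j)[r] = affineNode cs j i k s := by
  have hφ := phi_lt hi hk hs
  obtain ⟨m, rfl⟩ : ∃ m, r = m + 2 := ⟨r - 2, by rw [hr]; unfold affineIdx; omega⟩
  have hm : affineL cs j - 1 - m = (i * cs.length + k) * affineS cs + s := by
    rw [affineIdx] at hr; omega
  obtain ⟨e1, e2, e3⟩ := decode_state (i := i) hk hs
  rw [getElem_node, hm, e1, e2, e3]

/-- **Validity of the layout**: the successors of the state with flow number `φ < L` have index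
`< L + 1 - φ`, the index of the state. [folklore] -/
theorem affineSucc_lt {cs : List ℤ} (j φ : ℕ) (hφ : φ < affineL cs j) (hN : 0 < cs.length)
    (s' : ℕ) : affineSucc cs j (φ / affineS cs / cs.length) (φ / affineS cs % cs.length) s'
      < affineL cs j + 1 - φ := by
  have hk := Nat.mod_lt (φ / affineS cs) hN
  have hs := Nat.mod_lt φ (show 0 < affineS cs by unfold affineS; omega)
  have hd := decode_eq φ cs.length (affineS cs)
  unfold affineSucc affineIdx
  split_ifs with h1 h2
  · rw [Nat.add_one_mul]; omega
  · have e : (φ / affineS cs / cs.length + 1) * cs.length =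
        φ / affineS cs / cs.length * cs.length + φ / affineS cs % cs.length + 1 := by
      rw [Nat.add_one_mul]; omega
    rw [e, Nat.add_one_mul]; omega
  · omega

/-- Successor indices are nodes of the program. [folklore] -/
theorem affineSucc_lt_length (cs : List ℤ) (j i k s : ℕ) :
    affineSucc cs j i k s < (affineBitRaw cs j).length := by
  rw [length_affineBitRaw]
  unfold affineSucc affineIdx
  split_ifs <;> omega

/-- **Validity**: the carry automaton is a valid raw program over `N` variables. [folklore] -/
theorem valid (cs : List ℤ) (j : ℕ) : RawBP.Valid cs.length (affineBitRaw cs j) := by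
  refine ⟨by rw [length_affineBitRaw]; omega, fun ⟨r, hr⟩ => ?_⟩
  simp only [Fin.getElem_fin]
  rcases lt_or_ge r 2 with h2 | h2
  · rw [getElem_sink cs j h2 hr]
    simp only [RawBP.nodeOK, Bool.or_eq_true, decide_eq_true_eq]
    left; omega
  · obtain ⟨m, rfl⟩ : ∃ m, r = m + 2 := ⟨r - 2, by omega⟩
    have hm : m < affineL cs j := by rw [length_affineBitRaw] at hr; omega
    have hN : 0 < cs.length := Nat.pos_of_ne_zero fun h0 => by simp [affineL, h0] at hm
    have hlt : ∀ s', affineSucc cs j ((affineL cs j - 1 - m) / affineS cs / cs.length)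
        ((affineL cs j - 1 - m) / affineS cs % cs.length) s' < m + 2 := fun s' => by
      have := affineSucc_lt j (affineL cs j - 1 - m) (by omega) hN s'; omega
    simp [getElem_node cs j m hr, affineNode, RawBP.nodeOK, Nat.mod_lt _ hN, hlt]

/-! ### Semantics: the value of the sinks and of the reachable flow states -/

/-- The sinks compute their labels: node `b < 2` computes `[b = 0]`. [folklore] -/
theorem eval_sinks {cs : List ℤ} {j : ℕ} (h : RawBP.Valid cs.length (affineBitRaw cs j))
    (u : Fin cs.length → Bool) {b : ℕ} (hb : b < 2) (hr : b < (affineBitRaw cs j).length) :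
    (RawBP.toBDD _ _ h).eval u ⟨b, hr⟩ = decide (b = 0) := by
  rw [eval_sink h u hr (getElem_sink cs j hb hr) (by omega), decide_eq_decide]; omega

/-- **One transition**: the reachable state `(i, k, carry_i + Σ_{k' < k} bit_i a_{k'})` has the
value of its successor with count `carry_i + Σ_{k' ≤ k} bit_i a_{k'}` (the node tests `u_k`, the
true literal adds bit `i` of `|c_k|`: bit `i` of the active weight is added). [folklore] -/
theorem eval_step (cs : List ℤ) (j : ℕ) (u : Fin cs.length → Bool)
    (h : RawBP.Valid cs.length (affineBitRaw cs j)) {i k : ℕ} (hi : i ≤ j) (hk : k < cs.length)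
    (r : ℕ) (hr : r < (affineBitRaw cs j).length)
    (hre : r = affineIdx cs j (i * cs.length + k) (carry (wt cs u) i + pcol (wt cs u) i k))
    (r' : ℕ) (hr' : r' < (affineBitRaw cs j).length)
    (hre' : r' = affineSucc cs j i k (carry (wt cs u) i + pcol (wt cs u) i (k + 1))) :
    (RawBP.toBDD _ _ h).eval u ⟨r, hr⟩ = (RawBP.toBDD _ _ h).eval u ⟨r', hr'⟩ := by
  have hsS : carry (wt cs u) i + pcol (wt cs u) i k < affineS cs := by
    have := carry_le (wt cs u) i; have := pcol_le (wt cs u) i k; unfold affineS; omega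
  have hs' : carry (wt cs u) i + pcol (wt cs u) i (k + 1) =
      carry (wt cs u) i + pcol (wt cs u) i k + wt cs u ⟨k, hk⟩ / 2 ^ i % 2 := by
    rw [pcol_succ _ _ hk, Nat.add_assoc]
  rw [eval_branch h u hr (getElem_state hi hk hsS r hre hr) le_rfl hk (affineSucc_lt_length ..)
    (affineSucc_lt_length ..)]
  cases hu : u ⟨k, hk⟩ <;> simp only [Bool.false_eq_true, ↓reduceIte] <;> congr 1 <;> ext <;>
    simp only <;> rw [List.getD_eq_getElem cs 0 hk, hre', hs'] <;> unfold wt <;>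
    by_cases h0 : 0 ≤ cs[k] <;> simp [h0, hu]

/-- **One column**: if the successor of the last summand of column `i` with the full count
`carry_i + col_i` has value `T`, then every reachable state of column `i` has value `T`
(induction on `N - k`). [folklore] -/
theorem eval_row (cs : List ℤ) (j : ℕ) (u : Fin cs.length → Bool)
    (h : RawBP.Valid cs.length (affineBitRaw cs j)) {i : ℕ} (hi : i ≤ j) (T : Bool)
    (hend : ∀ (r : ℕ) (hr : r < (affineBitRaw cs j).length),
      r = affineSucc cs j i (cs.length - 1) (carry (wt cs u) i + pcol (wt cs u) i cs.length) →
      (RawBP.toBDD _ _ h).eval u ⟨r, hr⟩ = T) :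
    ∀ (e k : ℕ), k + e + 1 = cs.length → ∀ (r : ℕ) (hr : r < (affineBitRaw cs j).length),
      r = affineIdx cs j (i * cs.length + k) (carry (wt cs u) i + pcol (wt cs u) i k) →
      (RawBP.toBDD _ _ h).eval u ⟨r, hr⟩ = T := by
  intro e
  induction e with
  | zero =>
    intro k hk r hr hre
    rw [eval_step cs j u h hi (by omega) r hr hre _ (affineSucc_lt_length ..) rfl]
    refine hend _ _ ?_
    obtain rfl : k = cs.length - 1 := by omega
    rw [Nat.sub_add_cancel (by omega)]
  | succ e ih =>
    intro k hk r hr hre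
    rw [eval_step cs j u h hi (by omega) r hr hre _ (affineSucc_lt_length ..) rfl]
    refine ih (k + 1) (by omega) _ _ ?_
    unfold affineSucc
    rw [if_pos (by omega), Nat.add_assoc]

/-- **The invariant of the carry automaton**: every reachable state
`(i, k, carry_i + Σ_{k'<k} bit_i a_{k'})` computes bit `j` of the value (induction on `j - i`: the
last column ends in the sink `(carry_j + col_j) mod 2 = bit_j`, an earlier column hands the carry
`(carry_i + col_i) / 2 = carry_{i+1}` to the next one). [folklore] -/
theorem eval_all (cs : List ℤ) (j : ℕ) (u : Fin cs.length → Bool)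
    (h : RawBP.Valid cs.length (affineBitRaw cs j)) :
    ∀ (d i : ℕ), i + d = j → ∀ (k : ℕ), k < cs.length →
    ∀ (r : ℕ) (hr : r < (affineBitRaw cs j).length),
      r = affineIdx cs j (i * cs.length + k) (carry (wt cs u) i + pcol (wt cs u) i k) →
      (RawBP.toBDD _ _ h).eval u ⟨r, hr⟩ = (affineVal cs u).testBit j := by
  intro d
  induction d with
  | zero =>
    intro i hi k hk r hr hre
    refine eval_row cs j u h (by omega) _ (fun r' hr' hre' => ?_) (cs.length - k - 1) k (by omega)
      r hr hre
    obtain rfl : i = j := by omega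
    unfold affineSucc at hre'
    rw [if_neg (by omega), if_neg (lt_irrefl _)] at hre'
    rw [show affineVal cs u = ∑ k, wt cs u k from rfl, testBit_sum (wt cs u) i,
      eval_sinks h u (by omega) hr', decide_eq_decide]
    omega
  | succ d ih =>
    intro i hi k hk r hr hre
    refine eval_row cs j u h (by omega) _ (fun r' hr' hre' => ?_) (cs.length - k - 1) k (by omega)
      r hr hre
    unfold affineSucc at hre'
    rw [if_neg (by omega), if_pos (by omega)] at hre'
    refine ih (i + 1) (by omega) 0 (by omega) r' hr' ?_
    rw [hre', carry_succ, pcol_zero]; simp only [Nat.add_zero]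

end SocketAffineBit

/-- **Socket rider, affine samplers (stub `stub_affineBitRaw_fn`)**: the carry automaton
`affineBitRaw cs j` is a valid raw branching program over the `|cs|` input bits and computes bit
`j` of the value `affineVal cs u` of the signed affine form — every integer affine form of the
input bits, written in binary, is a branching-program sampler with `O(j · |cs|²)` nodes per output
bit. [Wegener 2000, §1.1; folklore] -/
theorem stub_affineBitRaw_fn (cs : List ℤ) (j : ℕ) (u : Fin cs.length → Bool) : RawBP.Valid cs.length (affineBitRaw cs j) ∧ (RawBP.compile cs.length (affineBitRaw cs j)).2.fn u = (affineVal cs u).testBit j := by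
  have hV := SocketAffineBit.valid cs j
  refine ⟨hV, ?_⟩
  rw [RawBP.compile_of_valid hV]
  change (RawBP.toBDD _ _ hV).eval u ⟨(affineBitRaw cs j).length - 1, _⟩ = _
  rcases Nat.eq_zero_or_pos cs.length with hN | hN
  · have hL : affineL cs j = 0 := by simp [affineL, hN]
    have key : ∀ (r : ℕ) (hr : r < (affineBitRaw cs j).length), r = 1 →
        (RawBP.toBDD _ _ hV).eval u ⟨r, hr⟩ = false := fun r hr e => by
      subst e; exact SocketAffineBit.eval_sinks hV u one_lt_two hr
    rw [show affineVal cs u = 0 from Finset.sum_eq_zero fun k _ => absurd k.isLt (by omega),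
      Nat.zero_testBit]
    exact key _ _ (by rw [SocketAffineBit.length_affineBitRaw, hL])
  · exact SocketAffineBit.eval_all cs j u hV j 0 (by omega) 0 hN _ _ (by
      rw [SocketAffineBit.length_affineBitRaw, SocketAffineBit.carry_zero, SocketAffineBit.pcol_zero]
      simp [affineIdx])

end Summit.PneNP.PneNP.Cruxes.PeaThreeNotInP.SocketBP
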